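import Summits.QuantumFields.YangMills.Theorems.BalabanUVNodesN15CurvedDressedPairDefectExp
import Literature.MathematicalPhysics.QuantumFieldTheory.Balaban1983to89.B6Prop26ReachTransplant
import Literature.MathematicalPhysics.QuantumFieldTheory.Balaban1983to89.B11AxialTransport190
import HarnessLib

/-!
# Route «BalabanUVNodes» (cluster K4 «SpineRates»), Track-A DAG node N15 = NE2, BACKGROUND LAYER — THE CUBE STEP READ ON THE GLOBAL LATTICE AT TWO SPACINGS: majorants AND η-defects
# of a cube-local operator TRANSPLANTED by extension-by-zero carry the window indicators `1_{S_□}(y)·1_{S_□}(y′)` — the per-cube input shape of the [B6] gluing (dag-n15-c g11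
# `…N15TwoSpacingGluingCubes`), supplied from this seat's curved knit on a cube carrier

Cell `pub-ymgap`, seat `pub-ymgap-dag-n15-w3` (WIDTH SEAT 3∕3 on node N15, director-ym №197 ∕ HUMAN RULING D-0149; plan `W-SEAT-START-LIST.md` §n15 item 3 — eleventh piece, on dag-n15-c
g11's word (pub-ymgap INBOX l.26565 ∕ l.26652: «a cube-localized edition of `hasMaj_idef_curvDressed…` is exactly the per-cube input shape of `…GluingCubes`»).  `bears_on: R4∕N15 · K3⁷
SpineGivenEndpointR13SepCoPH (stmt-QuantumFields-20544)`.  Filed `--kind proof --supports stmt-QuantumFields-20544 --as helper` — COUNT-NEUTRAL.  Imports BY NAME this seat's file 7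
`…N15CurvedDressedPairDefectExp` (the cube engine `hasMaj_idef_curvDressed_exp_of_skew` this file serves; through it the lineage's `BackgroundLayer.idef_projO_comp`, `hasMaj_projO_comp`,
`projO`, `blkPair`, `liftPair`, `MatrixSpecies.liftMap`, `liftBlk`), lit `B6Prop26ReachTransplant` (`restrictOp`,
`extendOp`, `transplant`, `restrictOp_apply`, `restrictOp_apply_of_injOn`, `restrictOp_apply_of_not_mem`, `extendOp_apply`, `transplant_apply` — [B6] p. 238's identification
«□̃³ ⊂ T_η ↔ T_□»), lit `B11AxialTransport190` (`abs_le_loc_ofBlocks`, `loc_ofBlocks_le`), `B11SectG` (`HasMaj`, `BlockNorm.ofBlocks`), `T4EtaRateDefect.idef`, `T4EtaRateCoeffDefect.pull`;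
nothing in the tree is modified.

WHY.  [Balaban1985BackgroundPropagators] p. 399: *«Terms of these expansions are built of the above defined propagators localized to subdomains, e.g. to cubes … We have to prove the
theorems for the localized propagators … by using the regularity conditions (3.35) and expanding with respect to A.»*  [Balaban1984PropagatorsII] p. 238–239: *«We take the cube □̃³ and
identify it with a torus, denoted by T_□ … G₀ = Σ_{□∈𝒟} h_□G_□h_□»*, (2.133) p. 247: *«|(G_□J)(x)| … for x ∈ Δ(y), supp J ⊂ Δ(y′), y, y′ ∈ 𝔅 ∩ T_□»*.  dag-n15-c g11's FILES 43–46 type the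
GLUING at two spacings abstractly and display, per cube, the letters of a cube-localized operator READ ON THE GLOBAL LATTICE: block majorants and two-grid η-defects carrying the window
indicators.  This seat's knit (file 7) produces majorants∕defects of the dressed pair on ANY finite carrier — in particular on a cube's own lattice `X_□` (the torus `T_□`).  THIS FILE is
the bridge: the lit's `transplant W e T = ε ∘ T ∘ ρ` (extension by zero ∘ local operator ∘ restriction, window `W`, chart `e` bijective from `W` onto the local lattice, local blocks = global
blocks on the window) (i) carries a local `HasMaj (ofBlocks blk′) (ofBlocks blk′) T K` to `HasMaj (ofBlocks blk) (ofBlocks blk) (transplant W e T) (1_W(y)·1_W(y′)·K)` — the (2.133) shape —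
and, at two spacings with compatible windows∕charts (`W_f = π⁻¹W`, `e(πx) = π′(e_f x)`), (ii) the η-defect of the transplanted pair IS the transplant of the local η-defect:
`𝔇(ε_f T′ρ_f, εTρ) = ε_f ∘ 𝔇(T′, T) ∘ ρ`, so (iii) local two-grid defect letters become global ones with the same indicators.  §3 applies (i)–(iii) to the components of a pair-valued cube engine at two spacings — this
seat's dressed pairs (file 7's knit on a cube carrier, file 10's torus edition): the per-cube input of the gluing, at generator level.

* §1 `windowInd W blk y` (`= 1` iff the window meets the block of `y`, else `0`; `windowInd_le_of_one_le`: dominated by any consumer's cube indicator, pass by `HasMaj.mono`), `isLoc_restrictOp`, `loc_restrictOp_le`, `loc_extendOp_le`, ★★ `hasMaj_extend_comp_restrict` (the sandwich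
  `ε_f ∘ S ∘ ρ` of ANY local `S` between two local lattices: kernel `1_{W}(y′)·1_{W_f}(y)·K(y, y′)`), ★ `hasMaj_transplant` (one lattice: the (2.133) shape);
* §2 `pull_comp_extendOp`, `restrictOp_comp_pull`, ★★ `idef_transplant` (`𝔇(transplant W_f e_f T′, transplant W e T) = ε_f ∘ 𝔇(T′, T) ∘ ρ`), ★★ `hasMaj_idef_transplant`;
* §3 ★★★ `hasMaj_idef_transplant_pair_proj` — the components `j` (propagator ∕ covariant derivatives) of a pair-valued cube engine at two spacings (file 7's knit on a cube carrier, file 10's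
  torus edition), transplanted to the global lattices: two-grid defect `≤ 1_{W_f}(y)·1_W(y′)·K(y, y′)` with the engine's kernel `K` (the lineage's `idef_projO_comp` + `hasMaj_projO_comp` BY NAME)
  — the cube input of the gluing SUPPLIED; ★★ `hasMaj_transplant_pair_proj` (majorants likewise, from file 2's `hasMaj_curvDressed` shape); ★★ `hasMaj_idef_transplant_family` ∕
  ★★ `hasMaj_transplant_family` (a family of cubes, in the CONSUMER's indicators `χ_c ≥ 1_{W_c}` by `HasMaj.mono` — the `hDG` ∕ `hG`, `hG′` rows of dag-n15-c's `hasMaj_idef_glued_of_cubes`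
  (p596247, `χ_c = B6Prop26Gluing.ind (S_c)`) for `G_c := transplant (W_c) (e_c) (pr_j ∘ X̂_c)`).

HONEST FRAMING ∕ LIMITS.  Finite-lattice plumbing over the lit's transplant and this seat's knit; the cube's own hypotheses (inductive datum at the base point, carrier, smallness, generator
letters, skewness) stay displayed exactly as in file 7; the identification of the cube torus `T_□` with the window (bijective chart, blocks preserved) is the DISPLAYED geometric input
([B6] p. 238); the partition of unity, the commutator letters and the resummation are dag-n15-c's FILES 43–46 (not touched); nothing of [B6]∕[B9] asserted.  NE2⁺ NOT PRINTED, NOT proved;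
N15 NOT discharged; counts of record UNMOVED (typed 28∕28 · discharged 5∕27); one finite 𝕋⁴ at fixed ε — NOT infinite volume, NOT OS on ℝ⁴, NOT a mass gap, NOT Clay; R4 closes the
conditional finite-𝕋⁴ rung `BalabanLadder.UV` only.  Restate-immune (no Theses import).
-/

set_option autoImplicit false

noncomputable section
open scoped BigOperators
open Finset

namespace Summit.QuantumFields.YangMills.BalabanUVNodes.N15.CurvedSpecies

open Literature.MathematicalPhysics.QuantumFieldTheory.Balaban1983to89
open Literature.MathematicalPhysics.QuantumFieldTheory.Balaban1983to89.B11SectG (BlockNorm HasMaj)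
open Literature.MathematicalPhysics.QuantumFieldTheory.Balaban1983to89.B11AxialTransport190 (abs_le_loc_ofBlocks loc_ofBlocks_le)
open Literature.MathematicalPhysics.QuantumFieldTheory.Balaban1983to89.B6Prop26ReachTransplant (restrictOp extendOp transplant restrictOp_apply restrictOp_apply_of_injOn
  restrictOp_apply_of_not_mem extendOp_apply transplant_apply)
open Literature.MathematicalPhysics.QuantumFieldTheory.Balaban1983to89.T4EtaRateDefect (idef)
open Literature.MathematicalPhysics.QuantumFieldTheory.Balaban1983to89.T4EtaRateCoeffDefect (pull pull_apply)
open Summit.QuantumFields.YangMills.BalabanUVNodes.N15.MatrixSpecies (liftMap liftBlk)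

/-! ## §1 Majorants through extension-by-zero ∘ local operator ∘ restriction -/

section Sandwich

variable {g : B6.Geometry} {X X' : Type} [Fintype X] [Fintype X'] [DecidableEq X] [DecidableEq X']

/-- THE WINDOW INDICATOR on blocks: `1` if the window `W` meets the block of `y`, else `0` (the `1_{S_□}(y)` of the (2.133)-shaped cube letters).
[cite: Balaban1984PropagatorsII, (2.133) p.247 («y, y′ ∈ 𝔅 ∩ T_□»: shape)] -/
def windowInd (W : Finset X) (blk : X → g.Site) (y : g.Site) : ℝ := by
  classical exact if ∃ x ∈ W, blk x = y then 1 else 0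

omit [Fintype X] [DecidableEq X] [Fintype X'] [DecidableEq X'] in
/-- The indicator is `0` or `1`, in particular in `[0, 1]`. [folklore] -/
theorem windowInd_nonneg (W : Finset X) (blk : X → g.Site) (y : g.Site) : 0 ≤ windowInd W blk y := by
  unfold windowInd; split_ifs <;> norm_num

omit [Fintype X] [DecidableEq X] [Fintype X'] [DecidableEq X'] in
/-- On a block met by the window the indicator is `1`. [folklore] -/
theorem windowInd_of_mem {W : Finset X} {blk : X → g.Site} {y : g.Site} {x : X} (hx : x ∈ W) (hy : blk x = y) : windowInd W blk y = 1 := by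
  unfold windowInd; rw [if_pos ⟨x, hx, hy⟩]

omit [Fintype X] [DecidableEq X] [Fintype X'] [DecidableEq X'] in
/-- Off the blocks met by the window the indicator is `0`. [folklore] -/
theorem windowInd_of_not {W : Finset X} {blk : X → g.Site} {y : g.Site} (h : ¬∃ x ∈ W, blk x = y) : windowInd W blk y = 0 := by
  unfold windowInd; rw [if_neg h]

omit [Fintype X] [DecidableEq X] [Fintype X'] [DecidableEq X'] in
/-- DOMINATION BY ANY CUBE INDICATOR: a nonnegative weight `χ` that is `≥ 1` on every block met by the window dominates `windowInd` — so the letters below pass to a consumer's own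
indicator `1_{S_□}` (`S_□ ⊇` the blocks of the window) by `HasMaj.mono`. [folklore] -/
theorem windowInd_le_of_one_le {W : Finset X} {blk : X → g.Site} {χ : g.Site → ℝ} (hχ0 : ∀ y, 0 ≤ χ y) (hχ : ∀ x ∈ W, 1 ≤ χ (blk x)) (y : g.Site) :
    windowInd W blk y ≤ χ y := by
  by_cases h : ∃ x ∈ W, blk x = y
  · obtain ⟨x, hx, rfl⟩ := h
    rw [windowInd_of_mem hx rfl]; exact hχ x hx
  · rw [windowInd_of_not h]; exact hχ0 y

variable (W : Finset X) (e : X → X') (blk : X → g.Site) (blk' : X' → g.Site)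

omit [DecidableEq X] in
/-- RESTRICTION PRESERVES LOCALISATION: a global function supported in the block of `y′` restricts to a local function supported in the local block of `y′` (blocks agree on the
window). [folklore] -/
theorem isLoc_restrictOp (hblk : ∀ x ∈ W, blk' (e x) = blk x) {y' : g.Site} {μ : X → ℝ} (hμ : (BlockNorm.ofBlocks g blk).IsLoc y' μ) :
    (BlockNorm.ofBlocks g blk').IsLoc y' (restrictOp W e μ) := by
  intro x' hx'
  rw [restrictOp_apply]
  refine Finset.sum_eq_zero fun x hx => ?_
  rw [Finset.mem_filter] at hx
  by_cases hb : blk x = y'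
  · exact absurd (by rw [← hx.2, hblk x hx.1, hb]) hx'
  · exact hμ x hb

omit [DecidableEq X] in
/-- RESTRICTION DOES NOT INCREASE BLOCK SIZES (injective chart, blocks agree on the window): `loc′_{y}(ρμ) ≤ loc_{y}(μ)`. [folklore] -/
theorem loc_restrictOp_le (hinj : Set.InjOn e ↑W) (hblk : ∀ x ∈ W, blk' (e x) = blk x) (y : g.Site) (μ : X → ℝ) :
    (BlockNorm.ofBlocks g blk').loc y (restrictOp W e μ) ≤ (BlockNorm.ofBlocks g blk).loc y μ := by
  refine loc_ofBlocks_le blk' _ ((BlockNorm.ofBlocks g blk).loc_nonneg y μ) fun x' hx' => ?_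
  by_cases h : ∃ x ∈ W, e x = x'
  · obtain ⟨x, hx, rfl⟩ := h
    rw [restrictOp_apply_of_injOn hinj μ hx]
    exact abs_le_loc_ofBlocks blk μ (by rw [← hblk x hx]; exact hx')
  · rw [restrictOp_apply_of_not_mem μ fun x hx hex => h ⟨x, hx, hex⟩, abs_zero]
    exact (BlockNorm.ofBlocks g blk).loc_nonneg y μ

omit [DecidableEq X'] in
/-- EXTENSION BY ZERO DOES NOT INCREASE BLOCK SIZES (blocks agree on the window): `loc_y(εh) ≤ 1_W(y)·loc′_y(h)`. [folklore] -/
theorem loc_extendOp_le (hblk : ∀ x ∈ W, blk' (e x) = blk x) (y : g.Site) (h : X' → ℝ) :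
    (BlockNorm.ofBlocks g blk).loc y (extendOp W e h) ≤ windowInd W blk y * (BlockNorm.ofBlocks g blk').loc y h := by
  have hloc0 : 0 ≤ (BlockNorm.ofBlocks g blk').loc y h := (BlockNorm.ofBlocks g blk').loc_nonneg y h
  by_cases hW : ∃ x ∈ W, blk x = y
  · rw [windowInd_of_mem hW.choose_spec.1 hW.choose_spec.2, one_mul]
    refine loc_ofBlocks_le blk _ hloc0 fun x hx => ?_
    rw [extendOp_apply]
    split_ifs with hxW
    · exact abs_le_loc_ofBlocks blk' h (by rw [hblk x hxW, hx])
    · rw [abs_zero]; exact hloc0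
  · rw [windowInd_of_not hW, zero_mul]
    refine loc_ofBlocks_le blk _ le_rfl fun x hx => ?_
    rw [extendOp_apply, if_neg (fun hxW => hW ⟨x, hxW, hx⟩), abs_zero]

variable {Xf Xf' : Type} [Fintype Xf] [Fintype Xf'] [DecidableEq Xf] [DecidableEq Xf'] (Wf : Finset Xf) (ef : Xf → Xf') (blkf : Xf → g.Site) (blkf' : Xf' → g.Site)

omit [DecidableEq X] [DecidableEq Xf'] in
/-- ★★ **MAJORANTS THROUGH THE SANDWICH `ε_f ∘ S ∘ ρ`.**  A local operator `S` from the functions on the local lattice `X′` (blocks `blk′`) to those on the local lattice `X_f′` (blocks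
`blk_f′`) with `HasMaj … S K`, `K ≥ 0`; windows `W ⊂ X`, `W_f ⊂ X_f` with charts `e`, `e_f` injective on them and local blocks = global blocks on the windows.  Then the global operator
`extendOp W_f e_f ∘ S ∘ restrictOp W e` has the majorant `1_{W_f}(y)·1_W(y′)·K(y, y′)` between the global sharp-block sizes. [cite: Balaban1984PropagatorsII, (2.133) p.247 (shape), p.238 (T_□)] -/
theorem hasMaj_extend_comp_restrict (hinj : Set.InjOn e ↑W) (hblk : ∀ x ∈ W, blk' (e x) = blk x) (hblkf : ∀ x ∈ Wf, blkf' (ef x) = blkf x)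
    {S : (X' → ℝ) →ₗ[ℝ] (Xf' → ℝ)} {K : g.Site → g.Site → ℝ} (hK : ∀ a b, 0 ≤ K a b)
    (hS : HasMaj (BlockNorm.ofBlocks g blk') (BlockNorm.ofBlocks g blkf') S K) :
    HasMaj (BlockNorm.ofBlocks g blk) (BlockNorm.ofBlocks g blkf) (extendOp Wf ef ∘ₗ S ∘ₗ restrictOp W e)
      (fun y y' => windowInd Wf blkf y * windowInd W blk y' * K y y') := by
  intro y' μ hμ y
  dsimp only
  have hν := isLoc_restrictOp W e blk blk' hblk hμ
  have h1 := hS y' (restrictOp W e μ) hν y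
  have h2 := loc_restrictOp_le W e blk blk' hinj hblk y' μ
  have h3 := loc_extendOp_le Wf ef blkf blkf' hblkf y (S (restrictOp W e μ))
  have hι : 0 ≤ windowInd Wf blkf y := windowInd_nonneg _ _ _
  have hμ0 : 0 ≤ (BlockNorm.ofBlocks g blk).loc y' μ := (BlockNorm.ofBlocks g blk).loc_nonneg y' μ
  rw [LinearMap.comp_apply, LinearMap.comp_apply]
  by_cases hW : ∃ x ∈ W, blk x = y'
  · rw [windowInd_of_mem hW.choose_spec.1 hW.choose_spec.2, mul_one]
    calc _ ≤ windowInd Wf blkf y * (BlockNorm.ofBlocks g blkf').loc y (S (restrictOp W e μ)) := h3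
      _ ≤ windowInd Wf blkf y * (K y y' * (BlockNorm.ofBlocks g blk).loc y' μ) :=
          mul_le_mul_of_nonneg_left (h1.trans (mul_le_mul_of_nonneg_left h2 (hK _ _))) hι
      _ = windowInd Wf blkf y * K y y' * (BlockNorm.ofBlocks g blk).loc y' μ := by ring
  · -- the window misses the block of y′: the restriction vanishes
    have hρ : restrictOp W e μ = 0 := by
      funext x'
      rw [restrictOp_apply, Pi.zero_apply]
      refine Finset.sum_eq_zero fun x hx => ?_
      rw [Finset.mem_filter] at hx
      exact hμ x fun hb => hW ⟨x, hx.1, hb⟩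
    rw [hρ, map_zero, map_zero, (BlockNorm.ofBlocks g blkf).loc_zero]
    exact mul_nonneg (mul_nonneg (mul_nonneg hι (windowInd_nonneg _ _ _)) (hK _ _)) hμ0

/-- ★ **THE (2.133) SHAPE: a cube-local majorant read on the global lattice.**  One lattice (`X_f = X`, `W_f = W`): `transplant W e T` has the majorant `1_W(y)·1_W(y′)·K(y, y′)`.
[cite: Balaban1984PropagatorsII, (2.133) p.247, (2.90)–(2.91) p.239] -/
theorem hasMaj_transplant (hinj : Set.InjOn e ↑W) (hblk : ∀ x ∈ W, blk' (e x) = blk x) {T : Module.End ℝ (X' → ℝ)} {K : g.Site → g.Site → ℝ} (hK : ∀ a b, 0 ≤ K a b)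
    (hT : HasMaj (BlockNorm.ofBlocks g blk') (BlockNorm.ofBlocks g blk') T K) :
    HasMaj (BlockNorm.ofBlocks g blk) (BlockNorm.ofBlocks g blk) (transplant W e T) (fun y y' => windowInd W blk y * windowInd W blk y' * K y y') :=
  hasMaj_extend_comp_restrict W e blk blk' W e blk blk' hinj hblk hblk hK hT

end Sandwich

/-! ## §2 The η-defect of a transplanted pair is the transplant of the local η-defect -/

section Defect

variable {X X' Xf Xf' : Type} [Fintype X] [Fintype X'] [Fintype Xf] [Fintype Xf'] [DecidableEq X] [DecidableEq X'] [DecidableEq Xf] [DecidableEq Xf']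
variable (W : Finset X) (e : X → X') (Wf : Finset Xf) (ef : Xf → Xf') (π : Xf → X) (π' : Xf' → X')

omit [Fintype X] [Fintype X'] [Fintype Xf] [Fintype Xf'] [DecidableEq X'] [DecidableEq Xf'] in
/-- PULL-BACK THROUGH EXTENSION: with compatible windows (`x_f ∈ W_f ↔ πx_f ∈ W`) and charts (`e(πx_f) = π′(e_f x_f)` on `W_f`), `pull π ∘ ε_{W,e} = ε_{W_f,e_f} ∘ pull π′`. [folklore] -/
theorem pull_comp_extendOp (hW : ∀ xf, xf ∈ Wf ↔ π xf ∈ W) (hcompat : ∀ xf ∈ Wf, e (π xf) = π' (ef xf)) :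
    pull π ∘ₗ extendOp W e = extendOp Wf ef ∘ₗ pull π' := by
  apply LinearMap.ext; intro h; funext xf
  rw [LinearMap.comp_apply, LinearMap.comp_apply, pull_apply, extendOp_apply, extendOp_apply, pull_apply]
  by_cases hx : xf ∈ Wf
  · rw [if_pos ((hW xf).1 hx), if_pos hx, hcompat xf hx]
  · rw [if_neg (fun h' => hx ((hW xf).2 h')), if_neg hx]

omit [Fintype X] [Fintype X'] [Fintype Xf] [Fintype Xf'] [DecidableEq X] [DecidableEq Xf] in
/-- RESTRICTION THROUGH PULL-BACK: with charts BIJECTIVE from the windows onto the local lattices, compatible windows and charts, `ρ_{W_f,e_f} ∘ pull π = pull π′ ∘ ρ_{W,e}`. [folklore] -/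
theorem restrictOp_comp_pull (hinj : Set.InjOn e ↑W) (hinjf : Set.InjOn ef ↑Wf) (hsurjf : ∀ xf', ∃ xf ∈ Wf, ef xf = xf')
    (hW : ∀ xf, xf ∈ Wf ↔ π xf ∈ W) (hcompat : ∀ xf ∈ Wf, e (π xf) = π' (ef xf)) :
    restrictOp Wf ef ∘ₗ pull π = pull π' ∘ₗ restrictOp W e := by
  apply LinearMap.ext; intro f; funext xf'
  obtain ⟨xf, hxf, rfl⟩ := hsurjf xf'
  rw [LinearMap.comp_apply, LinearMap.comp_apply, restrictOp_apply_of_injOn hinjf _ hxf, pull_apply, pull_apply, ← hcompat xf hxf,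
    restrictOp_apply_of_injOn hinj _ ((hW xf).1 hxf)]

omit [Fintype X] [Fintype X'] [Fintype Xf] [Fintype Xf'] in
/-- ★★ **THE η-DEFECT OF A TRANSPLANTED PAIR IS THE TRANSPLANT OF THE LOCAL η-DEFECT**: `𝔇_{pull π, pull π}(transplant W_f e_f T′, transplant W e T) = ε_f ∘ 𝔇_{pull π′, pull π′}(T′, T) ∘ ρ`.
[folklore] -/
theorem idef_transplant (hinj : Set.InjOn e ↑W) (hinjf : Set.InjOn ef ↑Wf) (hsurjf : ∀ xf', ∃ xf ∈ Wf, ef xf = xf')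
    (hW : ∀ xf, xf ∈ Wf ↔ π xf ∈ W) (hcompat : ∀ xf ∈ Wf, e (π xf) = π' (ef xf)) (T : Module.End ℝ (X' → ℝ)) (T' : Module.End ℝ (Xf' → ℝ)) :
    idef (pull π) (pull π) (transplant Wf ef T') (transplant W e T) = extendOp Wf ef ∘ₗ idef (pull π') (pull π') T' T ∘ₗ restrictOp W e := by
  unfold idef transplant
  have h1 := restrictOp_comp_pull W e Wf ef π π' hinj hinjf hsurjf hW hcompat
  have h2 := pull_comp_extendOp W e Wf ef π π' hW hcompat
  calc (extendOp Wf ef ∘ₗ T' ∘ₗ restrictOp Wf ef) ∘ₗ pull π - pull π ∘ₗ (extendOp W e ∘ₗ T ∘ₗ restrictOp W e)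
      = extendOp Wf ef ∘ₗ T' ∘ₗ (restrictOp Wf ef ∘ₗ pull π) - (pull π ∘ₗ extendOp W e) ∘ₗ T ∘ₗ restrictOp W e := by
        simp only [LinearMap.comp_assoc]
    _ = extendOp Wf ef ∘ₗ T' ∘ₗ (pull π' ∘ₗ restrictOp W e) - (extendOp Wf ef ∘ₗ pull π') ∘ₗ T ∘ₗ restrictOp W e := by rw [h1, h2]
    _ = extendOp Wf ef ∘ₗ (T' ∘ₗ pull π' - pull π' ∘ₗ T) ∘ₗ restrictOp W e := by
        simp only [LinearMap.comp_assoc, LinearMap.comp_sub, LinearMap.sub_comp]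

variable {g : B6.Geometry} (blk : X → g.Site) (blk' : X' → g.Site) (blkf : Xf → g.Site) (blkf' : Xf' → g.Site)

/-- ★★ **TWO-GRID DEFECT LETTERS OF A CUBE-LOCAL PAIR, READ ON THE GLOBAL LATTICES**: if the local pair `(T′, T)` has `𝔇(T′, T) ≤ K` between the local block sizes, then the transplanted
pair has `𝔇 ≤ 1_{W_f}(y)·1_W(y′)·K(y, y′)` between the global ones. [cite: Balaban1984PropagatorsII, (2.133) p.247 (shape); Balaban1985BackgroundPropagators, p.399 (localized propagators)] -/
theorem hasMaj_idef_transplant (hinj : Set.InjOn e ↑W) (hinjf : Set.InjOn ef ↑Wf) (hsurjf : ∀ xf', ∃ xf ∈ Wf, ef xf = xf')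
    (hW : ∀ xf, xf ∈ Wf ↔ π xf ∈ W) (hcompat : ∀ xf ∈ Wf, e (π xf) = π' (ef xf)) (hblk : ∀ x ∈ W, blk' (e x) = blk x) (hblkf : ∀ x ∈ Wf, blkf' (ef x) = blkf x)
    {T : Module.End ℝ (X' → ℝ)} {T' : Module.End ℝ (Xf' → ℝ)} {K : g.Site → g.Site → ℝ} (hK : ∀ a b, 0 ≤ K a b)
    (hD : HasMaj (BlockNorm.ofBlocks g blk') (BlockNorm.ofBlocks g blkf') (idef (pull π') (pull π') T' T) K) :
    HasMaj (BlockNorm.ofBlocks g blk) (BlockNorm.ofBlocks g blkf) (idef (pull π) (pull π) (transplant Wf ef T') (transplant W e T))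
      (fun y y' => windowInd Wf blkf y * windowInd W blk y' * K y y') := by
  rw [idef_transplant W e Wf ef π π' hinj hinjf hsurjf hW hcompat]
  exact hasMaj_extend_comp_restrict W e blk blk' Wf ef blkf blkf' hinj hblk hblkf hK hD

end Defect

/-! ## §3 The dressed pairs of the curved knit on a cube carrier, component by component, read on the global lattices -/

section Cube

variable {geo : B6.Geometry} {Xc Xc' Y Yf ι J : Type} [Fintype Xc] [Fintype Xc'] [Fintype Y] [Fintype Yf] [Fintype ι] [Fintype J]
variable [DecidableEq Xc] [DecidableEq Xc'] [DecidableEq Y] [DecidableEq Yf] [DecidableEq ι] [DecidableEq J]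
variable (blk : Xc → geo.Site) (π : Xc' → Xc) (blkY : Y → geo.Site) (blkYf : Yf → geo.Site) (πY : Yf → Y)
variable (W : Finset Y) (e : Y → Xc × ι) (Wf : Finset Yf) (ef : Yf → Xc' × ι)

omit [DecidableEq J] in
/-- ★★★ **THE CUBE INPUT OF THE GLUING, TWO-GRID DEFECTS.**  A pair-valued cube engine at two spacings — operators `T : (X_□ × ι → ℝ) → ((X_□ × ι) × Option J → ℝ)` (coarse cube carrier) and
`T′` (fine cube carrier), e.g. THIS SEAT's dressed pairs `curvDressed …` with `key :=` file 7's `hasMaj_idef_curvDressed_exp_of_skew` (any finite cube carrier) or file 10's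
`hasMaj_idef_curvDressed_kingTorus` — whose η-defect through `(pull (liftMap π ι), pull (liftPair (liftMap π ι)))` has the block majorant `K ≥ 0`; global lattices `Y` (coarse), `Y_f`
(fine, block map `π_Y`) with windows `W`, `W_f = π_Y⁻¹W` charted BIJECTIVELY onto the cube carriers (`e`, `e_f`; `e(π_Y y) = (π × id)(e_f y)`; cube blocks = global blocks on the windows).
Then EVERY COMPONENT `j` (propagator `none`, covariant derivatives `some (inl∕inr μ)`), transplanted to the global lattices, has the two-grid defect majorant `1_{W_f}(y)·1_W(y′)·K(y, y′)` —
the per-cube input letter of dag-n15-c's `…N15TwoSpacingGluingCubes`. [cite: Balaban1984PropagatorsII, (2.133) p.247, (2.90)–(2.91) p.239 (shapes); Balaban1985BackgroundPropagators, p.399 (localized propagators)] -/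
theorem hasMaj_idef_transplant_pair_proj (hinj : Set.InjOn e ↑W) (hinjf : Set.InjOn ef ↑Wf) (hsurjf : ∀ p, ∃ yf ∈ Wf, ef yf = p)
    (hW : ∀ yf, yf ∈ Wf ↔ πY yf ∈ W) (hcompat : ∀ yf ∈ Wf, e (πY yf) = liftMap π ι (ef yf))
    (hblk : ∀ y ∈ W, liftBlk blk ι (e y) = blkY y) (hblkf : ∀ y ∈ Wf, liftBlk (blk ∘ π) ι (ef y) = blkYf y)
    {T : (Xc × ι → ℝ) →ₗ[ℝ] ((Xc × ι) × Option J → ℝ)} {T' : (Xc' × ι → ℝ) →ₗ[ℝ] ((Xc' × ι) × Option J → ℝ)} {K : geo.Site → geo.Site → ℝ} (hK : ∀ a b, 0 ≤ K a b)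
    (key : HasMaj (BlockNorm.ofBlocks geo (liftBlk blk ι)) (BlockNorm.ofBlocks geo (BackgroundLayer.blkPair (liftBlk (blk ∘ π) ι)))
      (idef (pull (liftMap π ι)) (pull (BackgroundLayer.liftPair (liftMap π ι))) T' T) K) (j : Option J) :
    HasMaj (BlockNorm.ofBlocks geo blkY) (BlockNorm.ofBlocks geo blkYf)
      (idef (pull πY) (pull πY) (transplant Wf ef (BackgroundLayer.projO j ∘ₗ T')) (transplant W e (BackgroundLayer.projO j ∘ₗ T)))
      (fun y y' => windowInd Wf blkYf y * windowInd W blkY y' * K y y') := by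
  have hj : HasMaj (BlockNorm.ofBlocks geo (liftBlk blk ι)) (BlockNorm.ofBlocks geo (liftBlk (blk ∘ π) ι))
      (idef (pull (liftMap π ι)) (pull (liftMap π ι)) (BackgroundLayer.projO j ∘ₗ T') (BackgroundLayer.projO j ∘ₗ T)) K := by
    rw [BackgroundLayer.idef_projO_comp]
    exact BackgroundLayer.hasMaj_projO_comp (liftBlk (blk ∘ π) ι) key j
  exact hasMaj_idef_transplant W e Wf ef πY (liftMap π ι) blkY (liftBlk blk ι) blkYf (liftBlk (blk ∘ π) ι) hinj hinjf hsurjf hW hcompat hblk hblkf hK hj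

omit [DecidableEq J] in
/-- ★★ **THE CUBE INPUT OF THE GLUING, MAJORANTS** (one grid): a pair-valued cube engine `T` with block majorant `K₀ ≥ 0` (e.g. this seat's file 2 `hasMaj_curvDressed`, dag-n15-w2's
`…_exp_of_skew` edition) gives, for every component `j`, the transplanted operator's majorant `1_W(y)·1_W(y′)·K₀(y, y′)` — the (2.133)-shaped letter. [cite: Balaban1984PropagatorsII, (2.133) p.247 (shape)] -/
theorem hasMaj_transplant_pair_proj (hinj : Set.InjOn e ↑W) (hblk : ∀ y ∈ W, liftBlk blk ι (e y) = blkY y)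
    {T : (Xc × ι → ℝ) →ₗ[ℝ] ((Xc × ι) × Option J → ℝ)} {K₀ : geo.Site → geo.Site → ℝ} (hK : ∀ a b, 0 ≤ K₀ a b)
    (key₀ : HasMaj (BlockNorm.ofBlocks geo (liftBlk blk ι)) (BlockNorm.ofBlocks geo (BackgroundLayer.blkPair (liftBlk blk ι))) T K₀) (j : Option J) :
    HasMaj (BlockNorm.ofBlocks geo blkY) (BlockNorm.ofBlocks geo blkY) (transplant W e (BackgroundLayer.projO j ∘ₗ T)) (fun y y' => windowInd W blkY y * windowInd W blkY y' * K₀ y y') :=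
  hasMaj_transplant W e blkY (liftBlk blk ι) hinj hblk hK (BackgroundLayer.hasMaj_projO_comp (liftBlk blk ι) key₀ j)

omit [DecidableEq J] in
/-- ★★ **A FAMILY OF CUBES, IN THE CONSUMER's INDICATORS.**  Cubes `c : C` with one carrier shape, per-cube windows∕charts∕engines, and the consumer's cube weights `χ_c, χ′_c ≥ 0` that are
`≥ 1` on the blocks met by the windows (`1_{S_□}` with `S_□ ⊇` the window's blocks): for every cube and component, the transplanted two-grid defect is `≤ χ′_c(y)·χ_c(y′)·K_c(y, y′)` —
the hypothesis list of a gluing theorem over cubes, verbatim up to the names of `χ`. [cite: Balaban1984PropagatorsII, (2.133) p.247, (2.91) p.239 (shapes)] -/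
theorem hasMaj_idef_transplant_family {C : Type} (Wc : C → Finset Y) (ec : C → Y → Xc × ι) (Wfc : C → Finset Yf) (efc : C → Yf → Xc' × ι)
    (χ : C → geo.Site → ℝ) (χf : C → geo.Site → ℝ) (hχ0 : ∀ c y, 0 ≤ χ c y) (hχf0 : ∀ c y, 0 ≤ χf c y)
    (hχ : ∀ c, ∀ y ∈ Wc c, 1 ≤ χ c (blkY y)) (hχf : ∀ c, ∀ y ∈ Wfc c, 1 ≤ χf c (blkYf y))
    (hinj : ∀ c, Set.InjOn (ec c) ↑(Wc c)) (hinjf : ∀ c, Set.InjOn (efc c) ↑(Wfc c)) (hsurjf : ∀ c p, ∃ yf ∈ Wfc c, efc c yf = p)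
    (hW : ∀ c yf, yf ∈ Wfc c ↔ πY yf ∈ Wc c) (hcompat : ∀ c, ∀ yf ∈ Wfc c, ec c (πY yf) = liftMap π ι (efc c yf))
    (hblk : ∀ c, ∀ y ∈ Wc c, liftBlk blk ι (ec c y) = blkY y) (hblkf : ∀ c, ∀ y ∈ Wfc c, liftBlk (blk ∘ π) ι (efc c y) = blkYf y)
    {T : C → (Xc × ι → ℝ) →ₗ[ℝ] ((Xc × ι) × Option J → ℝ)} {T' : C → (Xc' × ι → ℝ) →ₗ[ℝ] ((Xc' × ι) × Option J → ℝ)} {K : C → geo.Site → geo.Site → ℝ}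
    (hK : ∀ c a b, 0 ≤ K c a b)
    (key : ∀ c, HasMaj (BlockNorm.ofBlocks geo (liftBlk blk ι)) (BlockNorm.ofBlocks geo (BackgroundLayer.blkPair (liftBlk (blk ∘ π) ι)))
      (idef (pull (liftMap π ι)) (pull (BackgroundLayer.liftPair (liftMap π ι))) (T' c) (T c)) (K c)) (c : C) (j : Option J) :
    HasMaj (BlockNorm.ofBlocks geo blkY) (BlockNorm.ofBlocks geo blkYf)
      (idef (pull πY) (pull πY) (transplant (Wfc c) (efc c) (BackgroundLayer.projO j ∘ₗ T' c)) (transplant (Wc c) (ec c) (BackgroundLayer.projO j ∘ₗ T c)))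
      (fun y y' => χf c y * χ c y' * K c y y') := by
  refine (hasMaj_idef_transplant_pair_proj blk π blkY blkYf πY (Wc c) (ec c) (Wfc c) (efc c) (hinj c) (hinjf c) (hsurjf c) (hW c) (hcompat c) (hblk c) (hblkf c)
    (hK c) (key c) j).mono fun a b => ?_
  exact mul_le_mul (mul_le_mul (windowInd_le_of_one_le (hχf0 c) (hχf c) a) (windowInd_le_of_one_le (hχ0 c) (hχ c) b) (windowInd_nonneg _ _ _) (hχf0 c a))
    le_rfl (hK c a b) (mul_nonneg (hχf0 c a) (hχ0 c b))

omit [Fintype Xc'] [Fintype Yf] [DecidableEq Xc'] [DecidableEq Yf] [DecidableEq J] in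
/-- ★★ **A FAMILY OF CUBES, MAJORANTS, IN THE CONSUMER's INDICATORS** (one grid): the transplanted components' majorants `≤ χ_c(y)·χ_c(y′)·K₀_c(y, y′)` — the `hG`∕`hG′` rows of a gluing
theorem over cubes (dag-n15-c `hasMaj_idef_glued_of_cubes` with `χ_c = ind (S_c)`). [cite: Balaban1984PropagatorsII, (2.133) p.247 (shape)] -/
theorem hasMaj_transplant_family {C : Type} (Wc : C → Finset Y) (ec : C → Y → Xc × ι) (χ : C → geo.Site → ℝ) (hχ0 : ∀ c y, 0 ≤ χ c y)
    (hχ : ∀ c, ∀ y ∈ Wc c, 1 ≤ χ c (blkY y)) (hinj : ∀ c, Set.InjOn (ec c) ↑(Wc c)) (hblk : ∀ c, ∀ y ∈ Wc c, liftBlk blk ι (ec c y) = blkY y)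
    {T : C → (Xc × ι → ℝ) →ₗ[ℝ] ((Xc × ι) × Option J → ℝ)} {K₀ : C → geo.Site → geo.Site → ℝ} (hK : ∀ c a b, 0 ≤ K₀ c a b)
    (key₀ : ∀ c, HasMaj (BlockNorm.ofBlocks geo (liftBlk blk ι)) (BlockNorm.ofBlocks geo (BackgroundLayer.blkPair (liftBlk blk ι))) (T c) (K₀ c)) (c : C) (j : Option J) :
    HasMaj (BlockNorm.ofBlocks geo blkY) (BlockNorm.ofBlocks geo blkY) (transplant (Wc c) (ec c) (BackgroundLayer.projO j ∘ₗ T c)) (fun y y' => χ c y * χ c y' * K₀ c y y') := by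
  refine (hasMaj_transplant_pair_proj blk blkY (Wc c) (ec c) (hinj c) (hblk c) (hK c) (key₀ c) j).mono fun a b => ?_
  exact mul_le_mul (mul_le_mul (windowInd_le_of_one_le (hχ0 c) (hχ c) a) (windowInd_le_of_one_le (hχ0 c) (hχ c) b) (windowInd_nonneg _ _ _) (hχ0 c a))
    le_rfl (hK c a b) (mul_nonneg (hχ0 c a) (hχ0 c b))

end Cube

end Summit.QuantumFields.YangMills.BalabanUVNodes.N15.CurvedSpecies

end
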